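import Mathlib
import HarnessLib
import Summits.Ventures.LatticeQCDFlow.Exactness.RejectionSampling

/-!
# The capped rejection loop: a round cap `M` changes the output law by at most `ρ(reject)^M` on every event

HONEST FRAMING: exact (Metropolis-corrected) sampling algorithms for lattice gauge theory;
figures of merit are autocorrelation/cost numbers at stated couplings and volumes; no
continuum-physics claim.

Venture `LatticeQCDFlow` (cell pub-lqcd), topic `Exactness`, FANOUT row 9 (eng-latcore, the
engine `latflow.core`).  NEW WORK of the cell over row 9's `RejectionSampling.lean` (i.i.d. rounds
`rounds ρ`, halting events `HaltsAt n`, the uncapped output law `loopLaw ρ`); nothing is cited.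

The engine's rejection loops are written `for (it = 0; it < M; it++) { …; if (accept) return x; }
return x₀;` — `csrc/latcore_template.c` `sample_a0` (`M = 10⁴` Kennedy–Pendleton, `M = 10⁵` Creutz,
`x₀ = 1`), `csrc/cpn_kernel.c` `rng_vmf_w` (`M = 10⁶`, `x₀ = 1`); the typed loops of
`KennedyPendletonSampler.lean`, `CreutzSampler.lean`, `WoodSampler.lean` are uncapped ("NOT CLAIMED: the
round cap").  This file types the cap:

* `cappedLaw ρ M x₀` — the law of the capped program's output: the value of the first accepting round
  if it is among the first `M`, else `x₀`; **`cappedLaw_apply_eq_rounds`** — SEMANTICS: `cappedLaw … A`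
  is the probability, under the i.i.d. rounds, that the capped program outputs a value in `A`;
  `isProbabilityMeasure_cappedLaw` — it always halts;
* `rounds_noAccept` — the first `M` rounds all reject with probability `ρ(reject)^M`;
  `cappedLaw_apply` — `cappedLaw A = Σ_{n<M} ρ(reject)ⁿ ρ(A × {accept}) + ρ(reject)^M · 1_A(x₀)`;
* **`cappedLaw_le_loopLaw_add`**, **`loopLaw_le_cappedLaw_add`** — for every event `A`:
  `|cappedLaw A − loopLaw A| ≤ ρ(reject)^M` (two one-sided inequalities in `ℝ≥0∞`).

For the engine's caps the bound is `(1 − acc)^{10⁴}` etc., with `acc` the typed per-round acceptance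
(`kpRound_accept`, `woodRound_accept`, …); e.g. any `acc ≥ 10⁻²` gives `< e^{−100}`.  NOT CLAIMED: a
numerical value of `acc` at the engine's parameters (the typed constants are integrals), floating point.
-/

namespace Summit.Ventures.LatticeQCDFlow.Exactness

open MeasureTheory ProbabilityTheory Set
open scoped ENNReal

variable {X : Type*} [MeasurableSpace X]

section Cap

variable (ρ : Measure (X × Bool)) (M : ℕ) (x₀ : X)

/-- **The law of the capped loop's output**: the value carried by the first accepting round `n < M`,
and the default `x₀` on the event that the first `M` rounds all reject. -/
noncomputable def cappedLaw : Measure X :=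
  Measure.sum (fun n : Fin M => ((rounds ρ).restrict (HaltsAt n)).map fun ω => (ω n).1) +
    (rounds ρ) {ω | ∀ k < M, (ω k).2 = false} • Measure.dirac x₀

variable {ρ M x₀}

/-- I.i.d. probability rounds form a probability measure. -/
instance isProbabilityMeasure_rounds [IsProbabilityMeasure ρ] : IsProbabilityMeasure (rounds ρ) := by
  unfold rounds; infer_instance

/-- The event "the first `M` rounds all reject" is measurable. -/
theorem measurableSet_noAccept (M : ℕ) : MeasurableSet {ω : ℕ → X × Bool | ∀ k < M, (ω k).2 = false} := by
  have h : ∀ k : ℕ, MeasurableSet {ω : ℕ → X × Bool | (ω k).2 = false} := fun k =>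
    (measurable_pi_apply k).snd (measurableSet_singleton false)
  have : {ω : ℕ → X × Bool | ∀ k < M, (ω k).2 = false} = ⋂ k ∈ Finset.range M, {ω | (ω k).2 = false} := by
    ext ω; simp
  rw [this]
  exact Finset.measurableSet_biInter _ fun k _ => h k

/-- **The first `M` rounds all reject with probability `ρ(reject)^M`.** -/
theorem rounds_noAccept [IsProbabilityMeasure ρ] (M : ℕ) :
    rounds ρ {ω | ∀ k < M, (ω k).2 = false} = ρ (univ ×ˢ {false}) ^ M := by
  have hset : {ω : ℕ → X × Bool | ∀ k < M, (ω k).2 = false} =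
      Set.pi ↑(Finset.range M) (fun _ => (univ : Set X) ×ˢ ({false} : Set Bool)) := by
    ext ω
    simp only [mem_setOf_eq, mem_pi, Finset.coe_range, mem_Iio, mem_prod, mem_univ, mem_singleton_iff, true_and]
  rw [hset, rounds, Measure.infinitePi_pi _ (fun _ _ => MeasurableSet.univ.prod (measurableSet_singleton _)),
    Finset.prod_const, Finset.card_range]

/-- **Closed form**: `cappedLaw A = Σ_{n<M} ρ(reject)ⁿ ρ(A ×ˢ {true}) + ρ(reject)^M · 1_A(x₀)`. -/
theorem cappedLaw_apply [IsProbabilityMeasure ρ] {A : Set X} (hA : MeasurableSet A) :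
    cappedLaw ρ M x₀ A = ∑ n ∈ Finset.range M, ρ (univ ×ˢ {false}) ^ n * ρ (A ×ˢ {true}) +
      ρ (univ ×ˢ {false}) ^ M * A.indicator 1 x₀ := by
  rw [cappedLaw, Measure.add_apply, Measure.sum_apply _ hA, tsum_fintype, Measure.smul_apply, smul_eq_mul,
    Measure.dirac_apply' _ hA, rounds_noAccept, Fin.sum_univ_eq_sum_range (fun n => ((rounds ρ).restrict
      (HaltsAt n)).map (fun ω => (ω n).1) A) M]
  congr 1
  refine Finset.sum_congr rfl fun n _ => ?_
  rw [Measure.map_apply ((measurable_pi_apply n).fst) hA,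
    Measure.restrict_apply (((measurable_pi_apply n).fst) hA), inter_comm]
  exact rounds_haltsAt_inter hA n

/-- **Semantics**: `cappedLaw ρ M x₀ A` is the probability that the capped program outputs a value in
`A` — it halts at some round `n < M` with value in `A`, or no round `< M` accepts and `x₀ ∈ A`. -/
theorem cappedLaw_apply_eq_rounds {A : Set X} (hA : MeasurableSet A) :
    cappedLaw ρ M x₀ A = rounds ρ ({ω | ∃ n < M, ω ∈ HaltsAt n ∧ (ω n).1 ∈ A} ∪
      {ω | (∀ k < M, (ω k).2 = false) ∧ x₀ ∈ A}) := by
  classical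
  have hmeas : ∀ n : ℕ, MeasurableSet (HaltsAt n ∩ {ω : ℕ → X × Bool | (ω n).1 ∈ A}) := fun n =>
    (measurableSet_haltsAt n).inter (((measurable_pi_apply n).fst) hA)
  -- the halting part is a finite disjoint union
  have hU : {ω : ℕ → X × Bool | ∃ n < M, ω ∈ HaltsAt n ∧ (ω n).1 ∈ A} =
      ⋃ n ∈ Finset.range M, (HaltsAt n ∩ {ω | (ω n).1 ∈ A}) := by
    ext ω
    simp only [mem_setOf_eq, mem_iUnion, mem_inter_iff, Finset.mem_range, exists_prop]
  have hdisjU : Disjoint {ω : ℕ → X × Bool | ∃ n < M, ω ∈ HaltsAt n ∧ (ω n).1 ∈ A}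
      {ω | (∀ k < M, (ω k).2 = false) ∧ x₀ ∈ A} := by
    refine Set.disjoint_left.2 fun ω ⟨n, hn, hω, _⟩ h => ?_
    have := h.1 n hn
    rw [hω.1] at this
    exact Bool.noConfusion this
  rw [measure_union hdisjU ((measurableSet_noAccept M).inter (MeasurableSet.const (x₀ ∈ A))), hU,
    measure_biUnion_finset (fun m _ n _ hmn => Disjoint.mono inter_subset_left inter_subset_left (disjoint_haltsAt hmn))
      (fun n _ => hmeas n),
    cappedLaw, Measure.add_apply, Measure.sum_apply _ hA, tsum_fintype, Measure.smul_apply, smul_eq_mul,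
    Measure.dirac_apply' _ hA, Fin.sum_univ_eq_sum_range (fun n => ((rounds ρ).restrict
      (HaltsAt n)).map (fun ω => (ω n).1) A) M]
  congr 1
  · refine Finset.sum_congr rfl fun n _ => ?_
    rw [Measure.map_apply ((measurable_pi_apply n).fst) hA,
      Measure.restrict_apply (((measurable_pi_apply n).fst) hA), inter_comm]
    rfl
  · by_cases hx : x₀ ∈ A
    · rw [indicator_of_mem hx, Pi.one_apply, mul_one]
      congr 1; ext ω; simp [hx]
    · rw [indicator_of_notMem hx, mul_zero]
      convert (measure_empty (μ := rounds ρ)).symm using 2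
      ext ω; simp [hx]

/-- **The capped loop always halts**: its output law is a probability measure. -/
instance isProbabilityMeasure_cappedLaw [IsProbabilityMeasure ρ] : IsProbabilityMeasure (cappedLaw ρ M x₀) := by
  classical
  refine ⟨?_⟩
  rw [cappedLaw_apply_eq_rounds MeasurableSet.univ]
  convert measure_univ (μ := rounds ρ) using 2
  ext ω
  simp only [mem_univ, and_true, mem_union, mem_setOf_eq, iff_true]
  by_cases h : ∃ k < M, (ω k).2 = true
  · left
    refine ⟨Nat.find h, (Nat.find_spec h).1, (Nat.find_spec h).2, fun k hk => ?_⟩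
    have hk' := Nat.find_min h hk
    push Not at hk'
    have hkM : k < M := lt_trans hk (Nat.find_spec h).1
    simpa using hk' hkM
  · right
    push Not at h
    intro k hk
    simpa using h k hk

/-- The uncapped law splits at round `M`: `loopLaw A = Σ_{n<M} ρ(reject)ⁿ ρ(A × {true}) + ρ(reject)^M · loopLaw A`. -/
theorem loopLaw_apply_split [IsProbabilityMeasure ρ] {A : Set X} (hA : MeasurableSet A) (M : ℕ) :
    loopLaw ρ A = ∑ n ∈ Finset.range M, ρ (univ ×ˢ {false}) ^ n * ρ (A ×ˢ {true}) +
      ρ (univ ×ˢ {false}) ^ M * loopLaw ρ A := by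
  have h := loopLaw_apply_tsum (ρ := ρ) hA
  simp_rw [rounds_haltsAt_inter hA] at h
  conv_lhs => rw [h, ← Summable.sum_add_tsum_nat_add' (f := fun n => ρ (univ ×ˢ {false}) ^ n * ρ (A ×ˢ {true}))
    (k := M) ENNReal.summable]
  congr 1
  rw [h, ← ENNReal.tsum_mul_left]
  refine tsum_congr fun n => ?_
  rw [pow_add]; ring

/-- The uncapped loop is a sub-probability law: `loopLaw A ≤ 1`. -/
theorem loopLaw_apply_le_one [IsProbabilityMeasure ρ] {A : Set X} (hA : MeasurableSet A) : loopLaw ρ A ≤ 1 := by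
  rw [loopLaw_apply_eq_rounds hA]
  exact prob_le_one

/-- **Upper bound**: `cappedLaw A ≤ loopLaw A + ρ(reject)^M` for every event `A`. -/
theorem cappedLaw_le_loopLaw_add [IsProbabilityMeasure ρ] {A : Set X} (hA : MeasurableSet A) :
    cappedLaw ρ M x₀ A ≤ loopLaw ρ A + ρ (univ ×ˢ {false}) ^ M := by
  rw [cappedLaw_apply hA, loopLaw_apply_split hA M, add_assoc]
  refine add_le_add le_rfl ?_
  calc ρ (univ ×ˢ {false}) ^ M * A.indicator 1 x₀ ≤ ρ (univ ×ˢ {false}) ^ M * 1 :=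
        mul_le_mul' le_rfl (by by_cases hx : x₀ ∈ A <;> simp [hx])
    _ ≤ ρ (univ ×ˢ {false}) ^ M * loopLaw ρ A + ρ (univ ×ˢ {false}) ^ M := by rw [mul_one]; exact le_add_self

/-- **Lower bound**: `loopLaw A ≤ cappedLaw A + ρ(reject)^M` for every event `A`. -/
theorem loopLaw_le_cappedLaw_add [IsProbabilityMeasure ρ] {A : Set X} (hA : MeasurableSet A) :
    loopLaw ρ A ≤ cappedLaw ρ M x₀ A + ρ (univ ×ˢ {false}) ^ M := by
  rw [cappedLaw_apply hA, loopLaw_apply_split hA M, add_assoc]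
  refine add_le_add le_rfl ?_
  calc ρ (univ ×ˢ {false}) ^ M * loopLaw ρ A ≤ ρ (univ ×ˢ {false}) ^ M * 1 :=
        mul_le_mul' le_rfl (loopLaw_apply_le_one hA)
    _ ≤ ρ (univ ×ˢ {false}) ^ M * A.indicator 1 x₀ + ρ (univ ×ˢ {false}) ^ M := by rw [mul_one]; exact le_add_self

end Cap

end Summit.Ventures.LatticeQCDFlow.Exactness
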